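import Literature.Analysis.FluidPDE.OseenKernelSemigroup
import Literature.Analysis.FluidPDE.KNSSRemark61
import Literature.Analysis.UnboundedOperators.HeatKernelLpSmoothingProofs
import Literature.Analysis.FluidPDE.MildSolutionHeatFlowProofs
import HarnessLib

/-!
# Time continuity of the Oseen–Koch–Tataru kernel in `L¹`

Analysis/FluidPDE support file (everything proved, no definitions) for the discharge of the
named fact `kato_local_bounded` (`KatoContinuation.lean`): the continuity in time, in `L³`, of the
Duhamel term `B^ν_s(u,v)(t)` of bounded fields (`OseenBoundedFieldsContinuity.lean`) rests on the
`L¹`-in-space continuity in time of the kernel `K(τ, z)[a, b] = oseenKernel τ z a b` of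
`e^{τΔ}P∇·` (Koch–Tataru 2001, §2 (8)), integrated against the singular weight `τ^{-1/2}`:

* `norm_oseenKernel_neg_arg` — the kernel being odd in `z` (`oseenKernel_neg`,
  `KNSSRemark61.lean`), scalar majorants built from its norm are even;
* `oseenKernel_eq_sum_basis`, `norm_oseenKernel_sub_le_sum_basis` — expansion in an orthonormal
  basis: `‖K(τ₁,z)[p,q] - K(τ₂,z)[p,q]‖ ≤ (∑ᵢⱼ ‖K(τ₁,z)[eᵢ,eⱼ] - K(τ₂,z)[eᵢ,eⱼ]‖) ‖p‖ ‖q‖`, a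
  scalar majorant of the bilinear kernel increment;
* `tendsto_lintegral_enorm_oseenKernel_sub`, `tendsto_lintegral_sum_norm_oseenKernel_sub` —
  **`∫_{(0,S)} ‖K(ν(σ+h), ·)[a,b] - K(νσ, ·)[a,b]‖_{L¹} dσ → 0` as `h → 0⁺`** (and the summed
  version over a basis): for each `σ`, `K(νσ + νh) = e^{νhΔ} K(νσ)` (the semigroup law
  `heatExtension_oseenKernel`, `OseenKernelSemigroup.lean`) tends to `K(νσ)` in `L¹` by the
  strong continuity of the heat semigroup (`UnboundedOperators.tendsto_heatExtension_nhdsWithin_zero`,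
  discharged), with the integrable domination `2C(νσ)^{-1/2}‖a‖‖b‖` from the `L¹` kernel bound
  (`exists_lintegral_enorm_oseenKernel_le`); dominated convergence in `σ`.

## References

* H. Koch, D. Tataru, *Well-posedness for the Navier–Stokes equations*, Adv. Math. 157 (2001),
  §2 (6)–(8), §3 (14). [KochTataruAdvMath2001]
* P. G. Lemarié-Rieusset, *The Navier–Stokes Problem in the 21st Century*, CRC Press 2016,
  Prop. 6.4 (6.10), Thm. 6.1 (the Oseen tensor as `e^{τΔ}ℙ`, a semigroup in `τ`); proof of
  Thm. 7.5 (PDF pp. 157–158: continuity in time of `B(F,G)` through `W_{ν(t-s)} - W_{ν(θ-s)}`).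
  [LemarieRieusset2016]
-/

noncomputable section

open MeasureTheory TopologicalSpace Set Function Filter Metric InnerProductSpace
open _root_.Topology
open scoped ENNReal NNReal RealInnerProductSpace

namespace Literature.Analysis.FluidPDE

variable {E : Type*} [NormedAddCommGroup E] [InnerProductSpace ℝ E] [FiniteDimensional ℝ E]
  [MeasurableSpace E] [BorelSpace E]

/-! ### Parity of the kernel -/

section Parity

omit [FiniteDimensional ℝ E] [MeasurableSpace E] [BorelSpace E] in
/-- The norm of the kernel is even in `z` (the kernel is odd, `oseenKernel_neg`,
`KNSSRemark61.lean`). [folklore] -/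
theorem norm_oseenKernel_neg_arg (τ : ℝ) (z a b : E) :
    ‖oseenKernel τ (-z) a b‖ = ‖oseenKernel τ z a b‖ := by
  rw [oseenKernel_neg, norm_neg]

end Parity

/-! ### Expansion in an orthonormal basis: a scalar majorant for the bilinear kernel -/

section Basis

omit [FiniteDimensional ℝ E] [MeasurableSpace E] [BorelSpace E] in
/-- Expansion of the kernel in an orthonormal basis `e`:
`K(τ,z)[p,q] = ∑ᵢⱼ pᵢ qⱼ K(τ,z)[eᵢ,eⱼ]` (bilinearity). [folklore] -/
theorem oseenKernel_eq_sum_basis {ι : Type*} [Fintype ι] (e : OrthonormalBasis ι ℝ E) (τ : ℝ)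
    (z p q : E) :
    oseenKernel τ z p q = ∑ i, ∑ j, (e.repr p i * e.repr q j) • oseenKernel τ z (e i) (e j) := by
  -- linearity in each slot, packaged as linear maps
  set Lq : E →ₗ[ℝ] E :=
    { toFun := fun a => oseenKernel τ z a q
      map_add' := fun a a' => oseenKernel_add_left τ z a a' q
      map_smul' := fun c a => oseenKernel_smul_left τ z c a q } with hLq
  have h1 : oseenKernel τ z p q = ∑ i, e.repr p i • oseenKernel τ z (e i) q := by
    have h := map_sum Lq (fun i => e.repr p i • e i) Finset.univ
    simp only [hLq, LinearMap.coe_mk, AddHom.coe_mk, e.sum_repr, map_smul] at h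
    rw [h]
  rw [h1]
  refine Finset.sum_congr rfl fun i _ => ?_
  set Ri : E →ₗ[ℝ] E :=
    { toFun := fun b => oseenKernel τ z (e i) b
      map_add' := fun b b' => oseenKernel_add_right τ z (e i) b b'
      map_smul' := fun c b => oseenKernel_smul_right τ z c (e i) b } with hRi
  have h2 : oseenKernel τ z (e i) q = ∑ j, e.repr q j • oseenKernel τ z (e i) (e j) := by
    have h := map_sum Ri (fun j => e.repr q j • e j) Finset.univ
    simp only [hRi, LinearMap.coe_mk, AddHom.coe_mk, e.sum_repr, map_smul] at h
    rw [h]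
  rw [h2, Finset.smul_sum]
  refine Finset.sum_congr rfl fun j _ => ?_
  rw [smul_smul]

omit [FiniteDimensional ℝ E] [MeasurableSpace E] [BorelSpace E] in
/-- Coordinates in an orthonormal basis are bounded by the norm: `|pᵢ| ≤ ‖p‖`. [folklore] -/
theorem abs_repr_le_norm {ι : Type*} [Fintype ι] (e : OrthonormalBasis ι ℝ E) (p : E) (i : ι) :
    |e.repr p i| ≤ ‖p‖ := by
  rw [e.repr_apply_apply]
  calc |⟪e i, p⟫| ≤ ‖e i‖ * ‖p‖ := abs_real_inner_le_norm _ _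
    _ = ‖p‖ := by rw [e.orthonormal.1 i, one_mul]

omit [FiniteDimensional ℝ E] [MeasurableSpace E] [BorelSpace E] in
/-- **Scalar majorant of a difference of kernels**: for two times `τ₁, τ₂`,
`‖K(τ₁,z)[p,q] - K(τ₂,z)[p,q]‖ ≤ (∑ᵢⱼ ‖K(τ₁,z)[eᵢ,eⱼ] - K(τ₂,z)[eᵢ,eⱼ]‖) ‖p‖ ‖q‖`. [folklore] -/
theorem norm_oseenKernel_sub_le_sum_basis {ι : Type*} [Fintype ι] (e : OrthonormalBasis ι ℝ E)
    (τ₁ τ₂ : ℝ) (z p q : E) :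
    ‖oseenKernel τ₁ z p q - oseenKernel τ₂ z p q‖ ≤
      (∑ i, ∑ j, ‖oseenKernel τ₁ z (e i) (e j) - oseenKernel τ₂ z (e i) (e j)‖) * ‖p‖ * ‖q‖ := by
  rw [oseenKernel_eq_sum_basis e τ₁, oseenKernel_eq_sum_basis e τ₂, ← Finset.sum_sub_distrib]
  simp_rw [← Finset.sum_sub_distrib, ← smul_sub]
  calc ‖∑ i, ∑ j, (e.repr p i * e.repr q j) • (oseenKernel τ₁ z (e i) (e j) - oseenKernel τ₂ z (e i) (e j))‖
      ≤ ∑ i, ‖∑ j, (e.repr p i * e.repr q j) • (oseenKernel τ₁ z (e i) (e j) - oseenKernel τ₂ z (e i) (e j))‖ :=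
        norm_sum_le _ _
    _ ≤ ∑ i, ∑ j, ‖(e.repr p i * e.repr q j) • (oseenKernel τ₁ z (e i) (e j) - oseenKernel τ₂ z (e i) (e j))‖ :=
        Finset.sum_le_sum fun i _ => norm_sum_le _ _
    _ ≤ ∑ i, ∑ j, ‖p‖ * ‖q‖ * ‖oseenKernel τ₁ z (e i) (e j) - oseenKernel τ₂ z (e i) (e j)‖ := by
        refine Finset.sum_le_sum fun i _ => Finset.sum_le_sum fun j _ => ?_
        rw [norm_smul, Real.norm_eq_abs, abs_mul]
        gcongr
        · exact abs_repr_le_norm e p i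
        · exact abs_repr_le_norm e q j
    _ = (∑ i, ∑ j, ‖oseenKernel τ₁ z (e i) (e j) - oseenKernel τ₂ z (e i) (e j)‖) * ‖p‖ * ‖q‖ := by
        rw [Finset.sum_mul, Finset.sum_mul]
        refine Finset.sum_congr rfl fun i _ => ?_
        rw [Finset.sum_mul, Finset.sum_mul]
        refine Finset.sum_congr rfl fun j _ => ?_
        ring

end Basis

/-! ### Time continuity of the kernel in `L¹` -/

section TimeContinuity

/-- **The kernel is continuous in time in `L¹`, integrated against `σ^{-1/2}`**: for `ν > 0`,
`S > 0` and fixed vectors `a, b`,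
`∫_{(0,S)} ‖K(ν(σ+h), ·)[a,b] - K(νσ, ·)[a,b]‖_{L¹} dσ → 0` as `h → 0⁺`. For each `σ`,
`K(νσ + νh) = e^{νhΔ}K(νσ)` (semigroup law, `heatExtension_oseenKernel`) tends to `K(νσ)` in
`L¹` (strong continuity of the heat semigroup), dominated by `2C(νσ)^{-1/2}‖a‖‖b‖`, which is
integrable on `(0, S)`; dominated convergence in `σ`. [folklore] -/
theorem tendsto_lintegral_enorm_oseenKernel_sub {ν : ℝ} (hν : 0 < ν) {S : ℝ} (hS : 0 < S) (a b : E) :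
    Tendsto (fun h : ℝ => ∫⁻ σ in Ioo 0 S, ∫⁻ z,
        ‖oseenKernel (ν * (σ + h)) z a b - oseenKernel (ν * σ) z a b‖ₑ) (𝓝[>] 0) (𝓝 0) := by
  obtain ⟨C, hC, hK⟩ := exists_lintegral_enorm_oseenKernel_le (E := E)
  set F : ℝ → ℝ → ℝ≥0∞ := fun h σ => ∫⁻ z,
    ‖oseenKernel (ν * (σ + h)) z a b - oseenKernel (ν * σ) z a b‖ₑ with hF
  set bound : ℝ → ℝ≥0∞ := fun σ =>
    2 * (ENNReal.ofReal (C * (ν * σ) ^ (-(1 / 2 : ℝ))) * ‖a‖ₑ * ‖b‖ₑ) with hbound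
  -- measurability of `F h`
  have hFm : ∀ h, Measurable (F h) := by
    intro h
    have hmeas : Measurable (fun p : ℝ × E =>
        ‖oseenKernel (ν * (p.1 + h)) p.2 a b - oseenKernel (ν * p.1) p.2 a b‖ₑ) := by
      refine Measurable.enorm ?_
      refine (Measurable.oseenKernel_comp ?_ measurable_snd measurable_const measurable_const).sub
        (Measurable.oseenKernel_comp ?_ measurable_snd measurable_const measurable_const)
      · exact (measurable_fst.add_const h).const_mul ν
      · exact measurable_fst.const_mul ν
    exact hmeas.lintegral_prod_right'
  -- domination on `(0, S)` for `h > 0`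
  have hdom : ∀ h, 0 < h → ∀ σ ∈ Ioo 0 S, F h σ ≤ bound σ := by
    intro h hh σ hσ
    have h1 : 0 < ν * (σ + h) := mul_pos hν (by linarith [hσ.1])
    have h2 : 0 < ν * σ := mul_pos hν hσ.1
    calc F h σ ≤ ∫⁻ z, (‖oseenKernel (ν * (σ + h)) z a b‖ₑ + ‖oseenKernel (ν * σ) z a b‖ₑ) :=
          lintegral_mono fun z => enorm_sub_le
      _ = (∫⁻ z, ‖oseenKernel (ν * (σ + h)) z a b‖ₑ) + ∫⁻ z, ‖oseenKernel (ν * σ) z a b‖ₑ :=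
          lintegral_add_left ((measurable_oseenKernel_left (ν * (σ + h)) a b).enorm) _
      _ ≤ ENNReal.ofReal (C * (ν * (σ + h)) ^ (-(1 / 2 : ℝ))) * ‖a‖ₑ * ‖b‖ₑ +
            ENNReal.ofReal (C * (ν * σ) ^ (-(1 / 2 : ℝ))) * ‖a‖ₑ * ‖b‖ₑ :=
          add_le_add (hK h1 a b).2 (hK h2 a b).2
      _ ≤ ENNReal.ofReal (C * (ν * σ) ^ (-(1 / 2 : ℝ))) * ‖a‖ₑ * ‖b‖ₑ +
            ENNReal.ofReal (C * (ν * σ) ^ (-(1 / 2 : ℝ))) * ‖a‖ₑ * ‖b‖ₑ := by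
          have hmono : (ν * (σ + h)) ^ (-(1 / 2 : ℝ)) ≤ (ν * σ) ^ (-(1 / 2 : ℝ)) :=
            Real.rpow_le_rpow_of_nonpos h2 (by nlinarith) (by norm_num)
          gcongr
      _ = bound σ := by simp only [hbound]; ring
  -- the bound is integrable on `(0, S)`
  have hfin : ∫⁻ σ in Ioo 0 S, bound σ ≠ ⊤ := by
    have heq : ∀ σ ∈ Ioo 0 S, bound σ = ENNReal.ofReal (2 * C * ν ^ (-(1 / 2 : ℝ))) * ‖a‖ₑ * ‖b‖ₑ *
        ENNReal.ofReal (σ ^ (-(1 / 2 : ℝ))) := by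
      intro σ hσ
      have e2 : ENNReal.ofReal (2 * C * ν ^ (-(1 / 2 : ℝ))) =
          2 * ENNReal.ofReal (C * ν ^ (-(1 / 2 : ℝ))) := by
        rw [mul_assoc, ENNReal.ofReal_mul (by norm_num : (0:ℝ) ≤ 2), ENNReal.ofReal_ofNat]
      simp only [hbound]
      rw [e2, Real.mul_rpow hν.le hσ.1.le, ← mul_assoc C,
        ENNReal.ofReal_mul (by positivity : 0 ≤ C * ν ^ (-(1 / 2 : ℝ)))]
      ring
    rw [setLIntegral_congr_fun measurableSet_Ioo heq, lintegral_const_mul' _ _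
      (ENNReal.mul_ne_top (ENNReal.mul_ne_top ENNReal.ofReal_ne_top enorm_ne_top) enorm_ne_top),
      setLIntegral_Ioo_rpow_neg_half hS]
    exact ENNReal.mul_ne_top (ENNReal.mul_ne_top (ENNReal.mul_ne_top ENNReal.ofReal_ne_top
      enorm_ne_top) enorm_ne_top) ENNReal.ofReal_ne_top
  -- pointwise limit: strong continuity of the heat semigroup in `L¹`
  have hlim : ∀ σ ∈ Ioo 0 S, Tendsto (fun h => F h σ) (𝓝[>] 0) (𝓝 0) := by
    intro σ hσ
    have h2 : 0 < ν * σ := mul_pos hν hσ.1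
    set f : E → E := fun z => oseenKernel (ν * σ) z a b with hf
    have hfi : Integrable f := (hK h2 a b).1
    have hf1 : MemLp f 1 volume := memLp_one_iff_integrable.2 hfi
    have ht := UnboundedOperators.tendsto_heatExtension_nhdsWithin_zero_holds hf1 le_rfl
      ENNReal.one_ne_top
    -- compose with `h ↦ ν h`
    have hmap : Tendsto (fun h : ℝ => ν * h) (𝓝[>] 0) (𝓝[>] 0) := by
      refine tendsto_nhdsWithin_of_tendsto_nhds_of_eventually_within _ ?_ ?_
      · have h := ((continuous_const_mul ν).tendsto (0 : ℝ)).mono_left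
          (nhdsWithin_le_nhds (s := Ioi (0 : ℝ)))
        rwa [mul_zero] at h
      · exact eventually_nhdsWithin_of_forall fun h hh => mul_pos hν hh
    have hcomp := ht.comp hmap
    refine (tendsto_congr' ?_).1 hcomp
    filter_upwards [self_mem_nhdsWithin] with h hh
    simp only [Function.comp_apply, hF]
    rw [eLpNorm_one_eq_lintegral_enorm]
    refine lintegral_congr fun z => ?_
    simp only [Pi.sub_apply, hf]
    rw [heatExtension_oseenKernel h2 (mul_pos hν hh), mul_add]
  -- dominated convergence
  have h := tendsto_lintegral_filter_of_dominated_convergence (μ := volume.restrict (Ioo 0 S))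
    (l := 𝓝[>] (0 : ℝ)) (F := F) (f := fun _ => 0) bound
    (Eventually.of_forall hFm)
    (by
      filter_upwards [self_mem_nhdsWithin] with h hh
      exact (ae_restrict_iff' measurableSet_Ioo).2 (Eventually.of_forall fun σ hσ => hdom h hh σ hσ))
    hfin
    ((ae_restrict_iff' measurableSet_Ioo).2 (Eventually.of_forall fun σ hσ => hlim σ hσ))
  simpa using h

/-- **The summed majorant of the kernel increment tends to zero**: with an orthonormal basis
`e = stdOrthonormalBasis ℝ E`,
`∫_{(0,S)} ∫ ∑ᵢⱼ ‖K(ν(σ+h), z)[eᵢ,eⱼ] - K(νσ, z)[eᵢ,eⱼ]‖ dz dσ → 0` as `h → 0⁺` (finite sum of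
`tendsto_lintegral_enorm_oseenKernel_sub`). Together with `norm_oseenKernel_sub_le_sum_basis` this
is the `L¹`-in-space, `L¹_{σ^{-1/2}dσ}`-in-time continuity of the bilinear kernel used for the time
continuity of the Duhamel term in `L³`. [folklore] -/
theorem tendsto_lintegral_sum_norm_oseenKernel_sub {ν : ℝ} (hν : 0 < ν) {S : ℝ} (hS : 0 < S) :
    Tendsto (fun h : ℝ => ∫⁻ σ in Ioo 0 S, ∫⁻ z, ENNReal.ofReal
        (∑ i, ∑ j, ‖oseenKernel (ν * (σ + h)) z (stdOrthonormalBasis ℝ E i) (stdOrthonormalBasis ℝ E j) -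
          oseenKernel (ν * σ) z (stdOrthonormalBasis ℝ E i) (stdOrthonormalBasis ℝ E j)‖))
      (𝓝[>] 0) (𝓝 0) := by
  set e := stdOrthonormalBasis ℝ E with he
  set G : Fin (Module.finrank ℝ E) → Fin (Module.finrank ℝ E) → ℝ → ℝ × E → ℝ≥0∞ :=
    fun i j h p => ‖oseenKernel (ν * (p.1 + h)) p.2 (e i) (e j) - oseenKernel (ν * p.1) p.2 (e i) (e j)‖ₑ
    with hG
  have hGm : ∀ i j h, Measurable (G i j h) := by
    intro i j h
    refine Measurable.enorm ?_
    refine (Measurable.oseenKernel_comp ?_ measurable_snd measurable_const measurable_const).sub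
      (Measurable.oseenKernel_comp ?_ measurable_snd measurable_const measurable_const)
    · exact (measurable_fst.add_const h).const_mul ν
    · exact measurable_fst.const_mul ν
  -- rewrite the integrand as a finite sum of `ℝ≥0∞`-valued functions and swap sums and integrals
  have hrw : ∀ h, (fun σ => ∫⁻ z, ENNReal.ofReal
      (∑ i, ∑ j, ‖oseenKernel (ν * (σ + h)) z (e i) (e j) - oseenKernel (ν * σ) z (e i) (e j)‖)) =
      fun σ => ∑ i, ∑ j, ∫⁻ z, G i j h (σ, z) := by
    intro h
    funext σ
    have h1 : ∀ z, ENNReal.ofReal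
        (∑ i, ∑ j, ‖oseenKernel (ν * (σ + h)) z (e i) (e j) - oseenKernel (ν * σ) z (e i) (e j)‖) =
        ∑ i, ∑ j, G i j h (σ, z) := by
      intro z
      rw [ENNReal.ofReal_sum_of_nonneg (fun i _ => Finset.sum_nonneg fun j _ => norm_nonneg _)]
      refine Finset.sum_congr rfl fun i _ => ?_
      rw [ENNReal.ofReal_sum_of_nonneg (fun j _ => norm_nonneg _)]
      refine Finset.sum_congr rfl fun j _ => ?_
      rw [hG, ofReal_norm]
    simp_rw [h1]
    have hm1 : ∀ i j, Measurable (fun z => G i j h (σ, z)) := fun i j =>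
      (hGm i j h).comp (measurable_const.prodMk measurable_id)
    rw [lintegral_finsetSum Finset.univ (f := fun i z => ∑ j, G i j h (σ, z))
      (fun i _ => Finset.measurable_sum _ fun j _ => hm1 i j)]
    refine Finset.sum_congr rfl fun i _ => ?_
    rw [lintegral_finsetSum Finset.univ (f := fun j z => G i j h (σ, z)) (fun j _ => hm1 i j)]
  have hrw2 : ∀ h, ∫⁻ σ in Ioo 0 S, ∑ i, ∑ j, ∫⁻ z, G i j h (σ, z) =
      ∑ i, ∑ j, ∫⁻ σ in Ioo 0 S, ∫⁻ z, G i j h (σ, z) := by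
    intro h
    have hm2 : ∀ i j, Measurable (fun σ => ∫⁻ z, G i j h (σ, z)) := fun i j =>
      (hGm i j h).lintegral_prod_right'
    rw [lintegral_finsetSum Finset.univ (f := fun i σ => ∑ j, ∫⁻ z, G i j h (σ, z))
      (fun i _ => Finset.measurable_sum _ fun j _ => hm2 i j)]
    refine Finset.sum_congr rfl fun i _ => ?_
    rw [lintegral_finsetSum Finset.univ (f := fun j σ => ∫⁻ z, G i j h (σ, z)) (fun j _ => hm2 i j)]
  have hlim : ∀ i j, Tendsto (fun h => ∫⁻ σ in Ioo 0 S, ∫⁻ z, G i j h (σ, z)) (𝓝[>] 0) (𝓝 0) :=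
    fun i j => tendsto_lintegral_enorm_oseenKernel_sub hν hS (e i) (e j)
  have hsum := tendsto_finsetSum (Finset.univ) fun i (_ : i ∈ Finset.univ) =>
    tendsto_finsetSum (Finset.univ) fun j (_ : j ∈ Finset.univ) => hlim i j
  simp only [Finset.sum_const_zero] at hsum
  refine (tendsto_congr fun h => ?_).2 hsum
  change ∫⁻ σ in Ioo 0 S, (fun σ => ∫⁻ z, ENNReal.ofReal
      (∑ i, ∑ j, ‖oseenKernel (ν * (σ + h)) z (e i) (e j) - oseenKernel (ν * σ) z (e i) (e j)‖)) σ = _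
  rw [hrw h, hrw2 h]

end TimeContinuity

end Literature.Analysis.FluidPDE

end
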